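import Summits.CriticalPhenomena.PercolationContinuityZ3.Theses.PercTorusSliceFilling
import Literature.Probability.Percolation.SlabCriticalityInputs
import Literature.Probability.LatticeModels.IsingTransport
import HarnessLib

/-!
# Crux `PercTorusSliceFilling.NoCriticalTorusGiant` (stmt-CriticalPhenomena-5407), line `registered` (`birth`) — stub `stub_sfMassTransitive` (S2b)

Helper file for the crux skeleton `Cruxes/NoCriticalTorusGiant/Lines/birth.lean`. Proves exactly
the registered stub signature `stub_sfMassTransitive`; lands with
`--supports stmt-CriticalPhenomena-5407`.

## The statement (transitivity of the slice-filling mass)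

On the discrete torus `T_n = (ℤ/nℤ)³` (`torusGraph 3 n`, `n ≠ 0`), call the open cluster `C(x)` of
`x` slice-filling, `sf_x`, if `∃ i, ∀ t : ZMod n, ∃ y ∈ C(x), y i = t`, and put
`f_x(ω) := 1{sf_x(ω)} · |C(x)(ω)|`. Then `E_{T_n,p}[f_x] = E_{T_n,p}[f_0]` for every vertex `x` and
every edge density `p`.

## The argument (translation invariance)

The translation `τ_x : y ↦ y + x` (`Equiv.addRight x`) is a graph automorphism of the circulant
graph `torusGraph 3 n` (`torusGraph_adj_add_right`), so the induced relabelling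
`R := BondConfig.relabel (sym2Equiv τ_x)` of bond configurations preserves `P_{T_n,p}`
(`bondPercolation_map_relabel_iso`). Pointwise `f_x ∘ R = f_0`: the cluster of `x = τ_x 0` in
`R ω` is `τ_x '' C(0)(ω)` (`openCluster_relabel`), which has the same cardinality
(`Set.ncard_image_of_injective`) and is slice-filling iff `C(0)(ω)` is (substitute `t ↦ t ∓ x i`).
Hence `∫ f_x dP = ∫ f_x ∘ R dP = ∫ f_0 dP` (`MeasurePreserving.integral_comp'`).
-/

noncomputable section

namespace Summit.CriticalPhenomena.PercolationContinuityZ3.Theorems.PercTorusSliceFillingNoCriticalTorusGiant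

open MeasureTheory ProbabilityTheory
open Literature.Probability.Percolation Literature.Probability.LatticeModels

namespace S2b

variable {V W : Type*}

/-- The cluster image formula `openCluster_relabel` (`C_{φ·ω}(φ a) = φ '' C_ω(a)`) with the base
point `φ a` replaced by any `b = φ a`. -/
theorem openCluster_relabel_of_eq (φ : V ≃ W) (ω : BondConfig V) {a : V} {b : W} (hb : φ a = b) :
    openCluster (BondConfig.relabel (sym2Equiv φ) ω) b = φ '' openCluster ω a := by
  subst hb
  exact openCluster_relabel φ ω a

/-- Two indicators agree at two points that are simultaneously inside/outside their sets and
carry the same function value. -/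
theorem indicator_congr_of_iff_of_eq {α β : Type*} {A : Set α} {B : Set β} {f : α → ℝ} {g : β → ℝ}
    {a : α} {b : β} (hmem : a ∈ A ↔ b ∈ B) (hval : f a = g b) :
    A.indicator f a = B.indicator g b := by
  by_cases hb : b ∈ B
  · rw [Set.indicator_of_mem (hmem.2 hb), Set.indicator_of_mem hb, hval]
  · rw [Set.indicator_of_notMem (mt hmem.1 hb), Set.indicator_of_notMem hb]

/-- Slice-fillingness is translation covariant: `(· + x) '' C` meets every slice in some
direction iff `C` does. -/
theorem sliceFilling_image_addRight_iff {n : ℕ} (x : TorusSite 3 n) (C : Set (TorusSite 3 n)) :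
    (∃ i : Fin 3, ∀ t : ZMod n, ∃ y ∈ Equiv.addRight x '' C, y i = t) ↔
      ∃ i : Fin 3, ∀ t : ZMod n, ∃ y ∈ C, y i = t := by
  simp only [Set.exists_mem_image, Equiv.coe_addRight, Pi.add_apply]
  refine exists_congr fun i => ⟨fun h t => ?_, fun h t => ?_⟩
  · obtain ⟨y, hy, hyt⟩ := h (t + x i)
    exact ⟨y, hy, add_right_cancel hyt⟩
  · obtain ⟨y, hy, hyt⟩ := h (t - x i)
    exact ⟨y, hy, by rw [hyt, sub_add_cancel]⟩

/-- **Pointwise covariance of the slice-filling mass functional**: with `R` the relabelling along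
the translation `y ↦ y + x`, `f_x (R ω) = f_0 ω`. -/
theorem sfMass_relabel_addRight {n : ℕ} (x : TorusSite 3 n) (ω : BondConfig (TorusSite 3 n)) :
    {ω' | ∃ i : Fin 3, ∀ t : ZMod n, ∃ y ∈ openCluster ω' x, y i = t}.indicator
        (fun ω' => ((openCluster ω' x).ncard : ℝ))
        (BondConfig.relabel (sym2Equiv (Equiv.addRight x)) ω) =
      {ω' | ∃ i : Fin 3, ∀ t : ZMod n,
          ∃ y ∈ openCluster ω' (0 : TorusSite 3 n), y i = t}.indicator
        (fun ω' => ((openCluster ω' (0 : TorusSite 3 n)).ncard : ℝ)) ω := by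
  -- the cluster of `x = 0 + x` in the translated configuration is the translate of `C(0)`
  have hC : openCluster (BondConfig.relabel (sym2Equiv (Equiv.addRight x)) ω) x =
      Equiv.addRight x '' openCluster ω 0 :=
    openCluster_relabel_of_eq (Equiv.addRight x) ω (zero_add x)
  refine indicator_congr_of_iff_of_eq ?_ ?_
  · simp only [Set.mem_setOf_eq, hC]
    exact sliceFilling_image_addRight_iff x (openCluster ω 0)
  · simp only [hC, Set.ncard_image_of_injective _ (Equiv.injective _)]

end S2b

open S2b in
/-- **Stub S2b — transitivity of the slice-filling mass** (line `birth` of crux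
`NoCriticalTorusGiant`, stmt-CriticalPhenomena-5407; exactly the registered signature).  For
`n ≠ 0`, every vertex `x` of `T_n = (ℤ/nℤ)³` and every `p`,
`E_{T_n,p}[|C(x)| · 1{sf_x}] = E_{T_n,p}[|C(0)| · 1{sf_0}]`: the translation `y ↦ y + x` is a
graph automorphism of `torusGraph 3 n` (`torusGraph_adj_add_right`), hence its relabelling `R`
preserves `P_{T_n,p}` (`bondPercolation_map_relabel_iso`), and `f_x ∘ R = f_0` pointwise
(`S2b.sfMass_relabel_addRight`). -/
theorem stub_sfMassTransitive :
    ∀ (p : unitInterval) (n : ℕ) [NeZero n] (x : TorusSite 3 n),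
      ∫ ω, {ω' | ∃ i : Fin 3, ∀ t : ZMod n, ∃ y ∈ openCluster ω' x, y i = t}.indicator
          (fun ω' => ((openCluster ω' x).ncard : ℝ)) ω ∂(bondPercolation (torusGraph 3 n) p) =
        ∫ ω, {ω' | ∃ i : Fin 3, ∀ t : ZMod n,
            ∃ y ∈ openCluster ω' (0 : TorusSite 3 n), y i = t}.indicator
          (fun ω' => ((openCluster ω' (0 : TorusSite 3 n)).ncard : ℝ)) ω
          ∂(bondPercolation (torusGraph 3 n) p) := by
  intro p n _ x
  -- the translation `y ↦ y + x` as a graph automorphism of the torus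
  let φ : torusGraph 3 n ≃g torusGraph 3 n :=
    { toEquiv := Equiv.addRight x
      map_rel_iff' := fun {a b} => torusGraph_adj_add_right x a b }
  -- its relabelling preserves the percolation measure
  have hmp : MeasurePreserving (BondConfig.relabel (sym2Equiv (Equiv.addRight x)))
      (bondPercolation (torusGraph 3 n) p) (bondPercolation (torusGraph 3 n) p) :=
    ⟨(BondConfig.relabel _).measurable, bondPercolation_map_relabel_iso φ p⟩
  refine (hmp.integral_comp' _).symm.trans ?_
  exact integral_congr_ae (Filter.Eventually.of_forall fun ω => sfMass_relabel_addRight x ω)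

end Summit.CriticalPhenomena.PercolationContinuityZ3.Theorems.PercTorusSliceFillingNoCriticalTorusGiant

end
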